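import Summits.QuantumFields.YangMills.Theorems.UnitScaleTiltAxialGaugeChartGlue
import Summits.QuantumFields.YangMills.Theorems.UnitScaleTiltProp7BlockDistanceWeights
import Summits.QuantumFields.YangMills.Theorems.UnitScaleTiltProp7SectET3HilbertLettersT3
import HarnessLib

/-!
# Route `UnitScaleTilt`, crux K1 «MinimiserStabilityRegPr» (stmt-QuantumFields-19200), EX face — (L3′b)-GRAD FILE **(G1-3b)(ii-a): THE BALL LETTERS OF ONE BOND** —
# everything the per-bond discharge of ✓`Prop7WeightedGradientAbsorption.hDcol_of_perBond`'s `hloc`∕`hm` needs that does NOT touch the gauge transport `Φ`∕`Ψ`: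
# the sup-ball of radius `12ℓ + 4` about the charted bond source `e c` (`ℓ = L^{K−n}`, `e = siteEquiv F K`) sits inside the coarse `ℓ¹`-ball of radius `51` about the block
# of `c`; a pointwise row with coarse exponential decay, read on that ball, costs the slack `e^{51κ}`; the source∕penalty difference of the LOD column on the ball; and the two
# background rows of the torus axial gauge `V := U₀^{axialT U₀ c}` on that ball with their K-free envelopes `ℓδ ≤ 48ε`, `ℓΘ ≤ 4ε(3 + 2457·C)` (px12 g15's (ii) SPEC
# 2026-08-30 06:21Z; px19 g13 LOCATE 06:27Z).

Cell `ym3-torus` (YM ladder rung R3 = continuum SU(2) Yang–Mills on T³ — a RUNG, NOT the Clay problem: not d = 4, not infinite volume, not a mass gap);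
width seat `ym3-torus-px19` (gen 13); helper `--supports stmt-QuantumFields-19200`.  THEOREMS ONLY (0 `def`, 0 `sorry`, default heartbeats).

* §1 BALL ↦ COARSE: `site_tdist_le_of_ball` (`Site.tdist c (e⁻¹z) ≤ 3ρ` on `tdist (e c) z ≤ ρ`, ✓`site_tdist_le_three_mul_tdist_siteEquiv`), ★`tdist_iterBlockOf_le_of_ball`
  (`tdist(B c, B e⁻¹z) ≤ 51` on the `12ℓ+4` ball, ✓`tdist_iterBlockOf_le`), ★`exp_neg_mul_tdist_le_of_ball` (`e^{−κ d(B e⁻¹z, y)} ≤ e^{51κ}·e^{−κ d(B c, y)}`).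
* §2 ★`decay_on_ball` — a pointwise row `f (e x) ≤ A·e^{−κ d(B x, y)}` read on the ball: `f z ≤ A·e^{51κ}·e^{−κ d(B c, y)}`; ★`norm_sub_le_on_ball` — the penalty-minus-source
  letter `‖(q − f)(z)‖ ≤ (A_pen + A_src)·e^{51κ}·e^{−κ d(B c, y)}` from a decaying penalty row, a bounded source row and the source's one-block support.
* §3 THE BACKGROUND ROWS OF `V := U₀^{axialT U₀ c}` ON THE BALL: ★`norm_bgOfCfg_axialT_sub_one_le_of_ball` (`‖V(z,μ) − 1‖ ≤ 3R·regThreshold` for `tdist (e c) z ≤ R`,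
  no wrap `2(R+1) ≤ sitesPerDir`; FIRST clause of (8), ✓`dist1_axialT_le_uniform`), the envelopes at `R := 12ℓ + 4 ≤ 16ℓ`: ★`ell_mul_delta_ball_le` (`ℓ·δ ≤ 48ε`),
  ★`ell_mul_theta_ball_le` (`ℓ·Θ ≤ 4ε·(3 + 2457·C)`, ✓`ell_mul_theta_le` at `r = 16`), and `natCast_radius` (`((12·L^{K−n} + 4 : ℕ) : ℝ) = 12ℓ + 4`).
HONEST SCOPE.  Metric∕letter bookkeeping; nothing of (G1-3b)(ii)'s knit, `hDcol`, the ten EX rows, `hT`, `hGF`, EX, `MinimiserStabilityRegPr` (19200) or the rung is proved;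
the Yang–Mills mass gap is NOT proved.
References: [Balaban1985BackgroundPropagators] Thm 3.1 (3.42)–(3.44) pp. 397–398, (3.45)–(3.47) p. 398 (local estimates on cubes, exponentially weighted sup);
[Balaban1985Averaging] (2) p. 17 (blocks), pp. 24–25 (axial gauge); [Balaban1985Variational] (2), (8) p. 278.
-/

set_option autoImplicit false

noncomputable section

open scoped Matrix.Norms.L2Operator
open Literature.MathematicalPhysics.QuantumFieldTheory.Balaban1983to89
open Literature.MathematicalPhysics.QuantumFieldTheory.Balaban1983to89.T3ContinuumYM3Torus (T3Family)
open Literature.MathematicalPhysics.QuantumFieldTheory.Balaban1983to89.T3RegularMinimiser (regThreshold)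
open Literature.MathematicalPhysics.QuantumFieldTheory.Balaban1983to89.B10Eq27TorusAxialLog (transl transl_rel rel axialT)
open Literature.MathematicalPhysics.QuantumFieldTheory.Balaban1983to89.B4Sect5Torus (TSite tdist tdist_triangle tdist_symm tdist_nonneg)
open Literature.MathematicalPhysics.QuantumFieldTheory.Balaban1983to89.B5Eq118OneStroke (iterBlockOf)
open Literature.MathematicalPhysics.QuantumFieldTheory.Balaban1983to89.B3Taylor310LocalRemainder (tdist_comm)
open Literature.MathematicalPhysics.QuantumFieldTheory.Balaban1983to89.B9Eq311L2Pairing (WL2)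
open Literature.MathematicalPhysics.QuantumFieldTheory.Balaban1983to89.B11Eq103H1Complex (SiteL2K)
open Summit.QuantumFields.YangMills.Theorems.Prop7SectET3Transport (periodsT3 siteEquiv bgOfCfg)
open Summit.QuantumFields.YangMills.Theorems.Prop7SectET3HilbertLetters (W₂)
open Summit.QuantumFields.YangMills.Theorems.Prop7BlockDistanceWeights (tdist_iterBlockOf_le)
open Summit.QuantumFields.YangMills.Theorems.AxialGaugeMemberModulus (dist1_axialT_le_uniform)
open Summit.QuantumFields.YangMills.Theorems.AxialGaugeChartGlue (abs_rel_le_of_tdist_le val_bgOfCfg_pair site_tdist_le_three_mul_tdist_siteEquiv ell_mul_delta_le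
  ell_mul_theta_le)

namespace Summit.QuantumFields.YangMills.Theorems.Prop7CurvedMemberBallLetters

variable (F : T3Family) (n K : ℕ)

/-! ## §1 The sup-ball of radius `12ℓ + 4` about `e c` sits in the coarse `ℓ¹`-ball of radius `51` about `B c` -/

omit n in
/-- `Site.tdist c (e⁻¹ z) ≤ 3ρ` whenever `tdist (e c) z ≤ ρ` (`ρ : ℕ`). [folklore] -/
theorem site_tdist_le_of_ball (c : Site (F.P K) 0) (z : TSite 3 (periodsT3 F K)) {ρ : ℕ} (hz : tdist (periodsT3 F K) (siteEquiv F K c) z ≤ ρ) :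
    Site.tdist c ((siteEquiv F K).symm z) ≤ 3 * ρ := by
  have h1 := site_tdist_le_three_mul_tdist_siteEquiv F K c ((siteEquiv F K).symm z)
  rw [Equiv.apply_symm_apply] at h1
  have h2 : (Site.tdist c ((siteEquiv F K).symm z) : ℝ) ≤ 3 * (ρ : ℝ) := h1.trans (by linarith)
  exact_mod_cast h2

/-- The radius letter: `((12·L^{K−n} + 4 : ℕ) : ℝ) = 12·ℓ + 4`. [folklore] -/
theorem natCast_radius : ((12 * F.L ^ (K - n) + 4 : ℕ) : ℝ) = 12 * (F.L : ℝ) ^ (K - n) + 4 := by push_cast; ring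

/-- ★ **BALL ↦ COARSE**: on the sup-ball `tdist (e c) z ≤ 12ℓ + 4`, the blocks of `c` and of `e⁻¹ z` are within coarse `ℓ¹` distance `51`
(`Site.tdist c (e⁻¹z) ≤ 36ℓ + 12`, then ✓`tdist_iterBlockOf_le`: `≤ (36ℓ+12)∕ℓ + 3 ≤ 48 + 3`). [cite: Balaban1985Averaging, (2) p.17] -/
theorem tdist_iterBlockOf_le_of_ball (c : Site (F.P K) 0) (z : TSite 3 (periodsT3 F K))
    (hz : tdist (periodsT3 F K) (siteEquiv F K c) z ≤ 12 * (F.L : ℝ) ^ (K - n) + 4) :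
    (Site.tdist (iterBlockOf (K - n) c) (iterBlockOf (K - n) ((siteEquiv F K).symm z)) : ℝ) ≤ 51 := by
  have hz' : tdist (periodsT3 F K) (siteEquiv F K c) z ≤ ((12 * F.L ^ (K - n) + 4 : ℕ) : ℝ) := by rw [natCast_radius]; exact hz
  have h1 : Site.tdist c ((siteEquiv F K).symm z) ≤ 3 * (12 * F.L ^ (K - n) + 4) := site_tdist_le_of_ball F K c z hz'
  have hk : K - n ≤ (F.P K).m + (F.P K).K := by show K - n ≤ F.m + K; omega
  have h2 := tdist_iterBlockOf_le hk c ((siteEquiv F K).symm z)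
  have hL : 0 < F.L ^ (K - n) := pow_pos (by have := F.hL.2; omega) _
  have h3 : Site.tdist c ((siteEquiv F K).symm z) / (F.P K).L ^ (K - n) ≤ 48 := by
    show Site.tdist c ((siteEquiv F K).symm z) / F.L ^ (K - n) ≤ 48
    calc Site.tdist c ((siteEquiv F K).symm z) / F.L ^ (K - n) ≤ (48 * F.L ^ (K - n)) / F.L ^ (K - n) :=
          Nat.div_le_div_right (h1.trans (by nlinarith))
      _ = 48 := Nat.mul_div_cancel 48 hL
  have hd : (F.P K).d = 3 := rfl
  have h4 : Site.tdist (iterBlockOf (K - n) c) (iterBlockOf (K - n) ((siteEquiv F K).symm z)) ≤ 51 := by rw [hd] at h2; omega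
  exact_mod_cast h4

/-- ★ **THE SLACK**: for `κ ≥ 0` and `z` in the sup-ball about `e c`, `e^{−κ·d(B e⁻¹z, y)} ≤ e^{51κ}·e^{−κ·d(B c, y)}` (coarse triangle inequality). [cite: Balaban1985BackgroundPropagators, (3.42) p.397] -/
theorem exp_neg_mul_tdist_le_of_ball {κ : ℝ} (hκ : 0 ≤ κ) (c : Site (F.P K) 0) (z : TSite 3 (periodsT3 F K))
    (hz : tdist (periodsT3 F K) (siteEquiv F K c) z ≤ 12 * (F.L : ℝ) ^ (K - n) + 4) (y : Site (F.P K) (K - n)) :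
    Real.exp (-(κ * (Site.tdist (iterBlockOf (K - n) ((siteEquiv F K).symm z)) y : ℝ))) ≤
      Real.exp (51 * κ) * Real.exp (-(κ * (Site.tdist (iterBlockOf (K - n) c) y : ℝ))) := by
  rw [← Real.exp_add]
  refine Real.exp_le_exp.mpr ?_
  have h1 := tdist_iterBlockOf_le_of_ball F n K c z hz
  have h2 : (Site.tdist (iterBlockOf (K - n) c) y : ℝ) ≤ (Site.tdist (iterBlockOf (K - n) c) (iterBlockOf (K - n) ((siteEquiv F K).symm z)) : ℝ)
      + (Site.tdist (iterBlockOf (K - n) ((siteEquiv F K).symm z)) y : ℝ) := by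
    exact_mod_cast B3Taylor310LocalRemainder.tdist_triangle (iterBlockOf (K - n) c) (iterBlockOf (K - n) ((siteEquiv F K).symm z)) y
  nlinarith

/-! ## §2 Pointwise rows with coarse decay, read on the ball -/

/-- ★ **A DECAYING POINTWISE ROW READ ON THE BALL**: if `f (e x) ≤ A·e^{−κ·d(B x, y)}` at every route site (`A, κ ≥ 0`), then `f z ≤ A·e^{51κ}·e^{−κ·d(B c, y)}` for every `z` with
`tdist (e c) z ≤ 12ℓ + 4`. [cite: Balaban1985BackgroundPropagators, Thm 3.1 (3.42) p.397] -/
theorem decay_on_ball {f : TSite 3 (periodsT3 F K) → ℝ} {A κ : ℝ} (hA : 0 ≤ A) (hκ : 0 ≤ κ) (y : Site (F.P K) (K - n))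
    (hf : ∀ x : Site (F.P K) 0, f (siteEquiv F K x) ≤ A * Real.exp (-(κ * (Site.tdist (iterBlockOf (K - n) x) y : ℝ))))
    (c : Site (F.P K) 0) (z : TSite 3 (periodsT3 F K)) (hz : tdist (periodsT3 F K) (siteEquiv F K c) z ≤ 12 * (F.L : ℝ) ^ (K - n) + 4) :
    f z ≤ A * Real.exp (51 * κ) * Real.exp (-(κ * (Site.tdist (iterBlockOf (K - n) c) y : ℝ))) := by
  have h1 := hf ((siteEquiv F K).symm z)
  rw [Equiv.apply_symm_apply] at h1
  have h2 := exp_neg_mul_tdist_le_of_ball F n K hκ c z hz y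
  calc f z ≤ A * Real.exp (-(κ * (Site.tdist (iterBlockOf (K - n) ((siteEquiv F K).symm z)) y : ℝ))) := h1
    _ ≤ A * (Real.exp (51 * κ) * Real.exp (-(κ * (Site.tdist (iterBlockOf (K - n) c) y : ℝ)))) := mul_le_mul_of_nonneg_left h2 hA
    _ = _ := by ring

variable (c₀ : ℝ)

/-- ★ **THE PENALTY-MINUS-SOURCE LETTER ON THE BALL** (`M_q` of (G1-3a) for the LOD column): a site field `q` with the decaying pointwise row `‖q(e x)‖ ≤ A_pen·e^{−κ d(B x, y)}`, a site field
`f` bounded by `A_src` everywhere and SUPPORTED IN THE BLOCK `y` (`f (e x) = 0` whenever `B x ≠ y`) give, on the sup-ball about `e c`,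
`‖(q − f)(z)‖ ≤ (A_pen + A_src)·e^{51κ}·e^{−κ d(B c, y)}` (if the ball meets the block `y` then `d(B c, y) ≤ 51`). [cite: Balaban1985BackgroundPropagators, (3.24) p.394, (3.42) p.397] -/
theorem norm_sub_le_on_ball (q f : SiteL2K ℂ 3 (periodsT3 F K) c₀ W₂) {Apen Asrc κ : ℝ} (hApen : 0 ≤ Apen) (hAsrc : 0 ≤ Asrc) (hκ : 0 ≤ κ)
    (y : Site (F.P K) (K - n))
    (hq : ∀ x : Site (F.P K) 0, ‖WL2.equiv ℂ (fun _ : TSite 3 (periodsT3 F K) => c₀) W₂ q (siteEquiv F K x)‖ ≤ Apen * Real.exp (-(κ * (Site.tdist (iterBlockOf (K - n) x) y : ℝ))))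
    (hfA : ∀ xt : TSite 3 (periodsT3 F K), ‖WL2.equiv ℂ (fun _ : TSite 3 (periodsT3 F K) => c₀) W₂ f xt‖ ≤ Asrc)
    (hf0 : ∀ x : Site (F.P K) 0, iterBlockOf (K - n) x ≠ y → WL2.equiv ℂ (fun _ : TSite 3 (periodsT3 F K) => c₀) W₂ f (siteEquiv F K x) = 0)
    (c : Site (F.P K) 0) (z : TSite 3 (periodsT3 F K)) (hz : tdist (periodsT3 F K) (siteEquiv F K c) z ≤ 12 * (F.L : ℝ) ^ (K - n) + 4) :
    ‖WL2.equiv ℂ (fun _ : TSite 3 (periodsT3 F K) => c₀) W₂ (q - f) z‖ ≤ (Apen + Asrc) * Real.exp (51 * κ) * Real.exp (-(κ * (Site.tdist (iterBlockOf (K - n) c) y : ℝ))) := by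
  set E : ℝ := Real.exp (51 * κ) * Real.exp (-(κ * (Site.tdist (iterBlockOf (K - n) c) y : ℝ))) with hE
  have hE0 : 0 ≤ E := by positivity
  -- the penalty part
  have h1 : ‖WL2.equiv ℂ (fun _ : TSite 3 (periodsT3 F K) => c₀) W₂ q z‖ ≤ Apen * E := by
    have := decay_on_ball F n K (f := fun t => ‖WL2.equiv ℂ (fun _ : TSite 3 (periodsT3 F K) => c₀) W₂ q t‖) hApen hκ y hq c z hz
    simpa only [hE, mul_assoc] using this
  -- the source part: zero off the block, `≤ A_src ≤ A_src·E` on it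
  have h2 : ‖WL2.equiv ℂ (fun _ : TSite 3 (periodsT3 F K) => c₀) W₂ f z‖ ≤ Asrc * E := by
    by_cases hby : iterBlockOf (K - n) ((siteEquiv F K).symm z) = y
    · have hd : (Site.tdist (iterBlockOf (K - n) c) y : ℝ) ≤ 51 := by rw [← hby]; exact tdist_iterBlockOf_le_of_ball F n K c z hz
      have hE1 : 1 ≤ E := by
        rw [hE, ← Real.exp_add, ← Real.exp_zero]
        exact Real.exp_le_exp.mpr (by nlinarith)
      calc ‖WL2.equiv ℂ (fun _ : TSite 3 (periodsT3 F K) => c₀) W₂ f z‖ ≤ Asrc := hfA z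
        _ = Asrc * 1 := (mul_one _).symm
        _ ≤ Asrc * E := mul_le_mul_of_nonneg_left hE1 hAsrc
    · have h0 := hf0 ((siteEquiv F K).symm z) hby
      rw [Equiv.apply_symm_apply] at h0
      rw [h0, norm_zero]; positivity
  calc ‖WL2.equiv ℂ (fun _ : TSite 3 (periodsT3 F K) => c₀) W₂ (q - f) z‖
      = ‖WL2.equiv ℂ (fun _ : TSite 3 (periodsT3 F K) => c₀) W₂ q z - WL2.equiv ℂ (fun _ : TSite 3 (periodsT3 F K) => c₀) W₂ f z‖ := by rw [WL2.equiv_sub, Pi.sub_apply]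
    _ ≤ ‖WL2.equiv ℂ (fun _ : TSite 3 (periodsT3 F K) => c₀) W₂ q z‖ + ‖WL2.equiv ℂ (fun _ : TSite 3 (periodsT3 F K) => c₀) W₂ f z‖ := norm_sub_le _ _
    _ ≤ Apen * E + Asrc * E := add_le_add h1 h2
    _ = (Apen + Asrc) * Real.exp (51 * κ) * Real.exp (-(κ * (Site.tdist (iterBlockOf (K - n) c) y : ℝ))) := by rw [hE]; ring

/-! ## §3 The background rows of `V := U₀^{axialT U₀ c}` on the ball -/

/-- ★ **`‖V(z, μ) − 1‖ ≤ 3R·εη²` ON THE SUP-BALL OF RADIUS `R` ABOUT `e c`** for the torus axial gauge `V := U₀^{axialT U₀ c}` of a configuration with `PlaqSmall (regThreshold F n K ε) U₀`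
(`0 ≤ ε`), no wrap `2(R+1) ≤ sitesPerDir` — the box reading ✓`abs_rel_le_of_tdist_le` + ✓`dist1_axialT_le_uniform` + ✓`val_bgOfCfg_pair`. [cite: Balaban1985Averaging, pp.24-25; Balaban1985Variational, (2) p.278] -/
theorem norm_bgOfCfg_axialT_sub_one_le_of_ball {ε : ℝ} (hε : 0 ≤ ε) (U₀ : GaugeField (F.P K) 0 (Matrix.specialUnitaryGroup (Fin 2) ℂ))
    (hP : PlaqSmall (regThreshold F n K ε) U₀) (c : Site (F.P K) 0) {R : ℕ} (hroom : 2 * (R + 1) ≤ (F.P K).sitesPerDir 0) :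
    ∀ (z : TSite 3 (periodsT3 F K)) (μ : Fin 3), tdist (periodsT3 F K) (siteEquiv F K c) z ≤ R →
      ‖((bgOfCfg F K (GaugeField.gaugeAct (axialT U₀ c) U₀) (z, μ) : (Matrix (Fin 2) (Fin 2) ℂ)ˣ) : Matrix (Fin 2) (Fin 2) ℂ) - 1‖ ≤ 3 * (R : ℝ) * regThreshold F n K ε := by
  intro z μ hz
  have ha : 0 ≤ regThreshold F n K ε := by unfold regThreshold; positivity
  have hz' : tdist (periodsT3 F K) (siteEquiv F K c) (siteEquiv F K ((siteEquiv F K).symm z)) ≤ (R : ℝ) := by rwa [Equiv.apply_symm_apply]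
  have hbox : ∀ κ, |rel c ((siteEquiv F K).symm z) κ| ≤ (R : ℤ) := abs_rel_le_of_tdist_le F K hz'
  have h := dist1_axialT_le_uniform U₀ ha hP c hroom (rel c ((siteEquiv F K).symm z)) hbox μ
  rw [transl_rel] at h
  have hd3 : (((F.P K).d : ℕ) : ℝ) = 3 := by norm_num [show (F.P K).d = 3 from rfl]
  rw [hd3] at h
  rw [val_bgOfCfg_pair]
  exact h

/-- ★ **THE `ℓδ` ENVELOPE AT `R := 12ℓ + 4`**: `ℓ·(3R·εη²) ≤ 48·ε` (`R ≤ 16ℓ`; ✓`ell_mul_delta_le`). [cite: Balaban1985Variational, (2) p.278] -/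
theorem ell_mul_delta_ball_le {ε : ℝ} (hε : 0 ≤ ε) :
    (F.L : ℝ) ^ (K - n) * (3 * ((12 * F.L ^ (K - n) + 4 : ℕ) : ℝ) * regThreshold F n K ε) ≤ 48 * ε := by
  have hL1 : (1 : ℝ) ≤ (F.L : ℝ) := by have := F.hL.2; exact_mod_cast this.le
  have hℓ1 : (1 : ℝ) ≤ (F.L : ℝ) ^ (K - n) := one_le_pow₀ hL1
  have hR : (((12 * F.L ^ (K - n) + 4 : ℕ)) : ℝ) ≤ 16 * (F.L : ℝ) ^ (K - n) := by rw [natCast_radius]; linarith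
  have := ell_mul_delta_le F n K hε (r := 16) hR
  linarith

/-- ★ **THE `ℓΘ` ENVELOPE AT `R := 12ℓ + 4`**: the (★) bracket times `√(Rℓ)`, times `ℓ`, is `≤ 4ε·(3 + 2457·C)` (✓`ell_mul_theta_le` at `r = 16`: `√16 = 4`, `9·(1 + 16 + 256) = 2457`).
[cite: Balaban1985Variational, (8) p.278; Balaban1985RegularSpaces, (1.9) p.77] -/
theorem ell_mul_theta_ball_le {ε C : ℝ} (hε : 0 ≤ ε) (hε1 : ε ≤ 1) (hC : 0 ≤ C) :
    (F.L : ℝ) ^ (K - n) * ((3 * (ε * ((F.L : ℝ)⁻¹) ^ (2 * (K - n))) + (3 : ℝ) ^ 2 * (C * ((ε * ((F.L : ℝ)⁻¹) ^ (2 * (K - n))) +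
        ((12 * F.L ^ (K - n) + 4 : ℕ) : ℝ) * (ε * ((F.L : ℝ)⁻¹) ^ (3 * (K - n))) + (((12 * F.L ^ (K - n) + 4 : ℕ) : ℝ)) ^ 2 * (ε * ((F.L : ℝ)⁻¹) ^ (2 * (K - n))) ^ 2))) *
        Real.sqrt ((((12 * F.L ^ (K - n) + 4 : ℕ) : ℝ)) * (F.L : ℝ) ^ (K - n)))
      ≤ 4 * ε * (3 + 2457 * C) := by
  have hL1 : (1 : ℝ) ≤ (F.L : ℝ) := by have := F.hL.2; exact_mod_cast this.le
  have hℓ1 : (1 : ℝ) ≤ (F.L : ℝ) ^ (K - n) := one_le_pow₀ hL1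
  have hR : (((12 * F.L ^ (K - n) + 4 : ℕ)) : ℝ) ≤ 16 * (F.L : ℝ) ^ (K - n) := by rw [natCast_radius]; linarith
  have h := ell_mul_theta_le F n K hε hε1 hC (r := 16) (by norm_num) hR
  have h16 : Real.sqrt 16 = 4 := by
    rw [show (16 : ℝ) = 4 ^ 2 by norm_num, Real.sqrt_sq (by norm_num : (0 : ℝ) ≤ 4)]
  rw [h16] at h
  linarith

end Summit.QuantumFields.YangMills.Theorems.Prop7CurvedMemberBallLetters

end
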